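import Literature.NumberTheory.LFunctions.DirichletCharacterCRT
import HarnessLib

/-!
# The product of Dirichlet characters to coprime moduli, and its primitivity

Topic `Literature/NumberTheory/LFunctions`; companion of `DirichletCharacterCRT.lean` (the CRT
COMPONENTS `crtFst`, `crtSnd` of a character mod `a b`, `(a, b) = 1`, and "`χ` primitive ⇒ components
primitive").  This file supplies the INVERSE construction and the converse direction of
Montgomery–Vaughan's Lemma 9.3: for characters `ψ mod a`, `ξ mod b` with `(a, b) = 1`,

* `crtProd ψ ξ` — the character `n ↦ ψ(n) ξ(n)` mod `a b` (product of the two lifts);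
* `crtProd_apply_symm` (`(ψ ⊗ ξ)(e⁻¹(u, v)) = ψ(u) ξ(v)`), `crtProd_apply_natCast`
  (`(ψ ⊗ ξ)(n) = ψ(n) ξ(n)`), `crtFst_crtProd`, `crtSnd_crtProd`, `crtProd_crtFst_crtSnd`
  (so `(ψ, ξ) ↦ ψ ⊗ ξ` is a bijection onto the characters mod `a b`, `crtProd_injective`);
* **`isPrimitive_crtProd`** — if `ψ` and `ξ` are primitive then so is `ψ ⊗ ξ` ("the character `χ` is
  primitive modulo `q₁q₂` if and only if both `χ₁` and `χ₂` are primitive", MV Lemma 9.3; the "only if"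
  is `isPrimitive_crtFst/crtSnd` of the companion file).

Everything here is PROVED.  Consumer: the hybrid (two-family) large-sieve bookkeeping of
`Summits/Parity/GeneralizedHardyLittlewood` (crux `TypeI2Dilated`, line `peel-to-drappeau`,
stub `stub_mainTerms`), where characters `ψ* mod f` (from the smooth modulus) and `ξ* mod L''` (from the
dilation class) are merged into one primitive character mod `f L''`.

## References

* H. L. Montgomery, R. C. Vaughan, *Multiplicative Number Theory I*, CUP (2007), §9.1, Lemma 9.3.
  [cite: MontgomeryVaughan2007, Lemma 9.3]
-/

noncomputable section

open DirichletCharacter Finset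

namespace Literature.NumberTheory.LFunctions

variable {R : Type*} [CommRing R] {a b : ℕ}

/-! ### The product character -/

/-- The product `ψ ⊗ ξ` of characters `ψ mod a`, `ξ mod b` as a character mod `a b`: the product of
the two lifts (`DirichletCharacter.changeLevel`); for `(a, b) = 1` it is the character with CRT
components `ψ`, `ξ`, i.e. `n ↦ ψ(n) ξ(n)`. [cite: MontgomeryVaughan2007, Lemma 9.3] -/
def crtProd (ψ : DirichletCharacter R a) (ξ : DirichletCharacter R b) : DirichletCharacter R (a * b) :=
  changeLevel (dvd_mul_right a b) ψ * changeLevel (dvd_mul_left b a) ξ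

/-- `(ψ ⊗ ξ)(x) = ψ(x mod a) ξ(x mod b)` for every `x : ZMod (a b)` (no coprimality needed).
[cite: MontgomeryVaughan2007, Lemma 9.3] -/
theorem crtProd_apply [NeZero a] [NeZero b] (ψ : DirichletCharacter R a) (ξ : DirichletCharacter R b)
    (x : ZMod (a * b)) :
    crtProd ψ ξ x = ψ (ZMod.cast x : ZMod a) * ξ (ZMod.cast x : ZMod b) := by
  unfold crtProd
  rw [MulChar.mul_apply]
  by_cases hx : IsUnit x
  · obtain ⟨u, rfl⟩ := hx
    rw [changeLevel_eq_cast_of_dvd ψ (dvd_mul_right a b) u,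
      changeLevel_eq_cast_of_dvd ξ (dvd_mul_left b a) u]
  · -- `x` is not a unit: then one of the two reductions is not a unit either
    rw [MulChar.map_nonunit _ hx, zero_mul]
    have hab : ¬ (IsUnit (ZMod.cast x : ZMod a) ∧ IsUnit (ZMod.cast x : ZMod b)) := by
      rintro ⟨ha, hb⟩
      apply hx
      have hxa : (x.val : ZMod a) = (ZMod.cast x : ZMod a) := by
        rw [ZMod.cast_eq_val]
      have hxb : (x.val : ZMod b) = (ZMod.cast x : ZMod b) := by
        rw [ZMod.cast_eq_val]
      have ca : x.val.Coprime a := (ZMod.isUnit_iff_coprime x.val a).1 (hxa ▸ ha)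
      have cb : x.val.Coprime b := (ZMod.isUnit_iff_coprime x.val b).1 (hxb ▸ hb)
      have : IsUnit ((x.val : ℕ) : ZMod (a * b)) :=
        (ZMod.isUnit_iff_coprime x.val (a * b)).2 (Nat.Coprime.mul_right ca cb)
      rwa [ZMod.natCast_zmod_val] at this
    rcases not_and_or.1 hab with ha | hb
    · rw [MulChar.map_nonunit _ ha, zero_mul]
    · rw [MulChar.map_nonunit _ hb, mul_zero]

/-- `(ψ ⊗ ξ)(n) = ψ(n) ξ(n)` for natural numbers `n`. [cite: MontgomeryVaughan2007, Lemma 9.3] -/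
theorem crtProd_apply_natCast [NeZero a] [NeZero b] (ψ : DirichletCharacter R a)
    (ξ : DirichletCharacter R b) (n : ℕ) :
    crtProd ψ ξ (n : ZMod (a * b)) = ψ (n : ZMod a) * ξ (n : ZMod b) := by
  rw [crtProd_apply, ZMod.cast_natCast (dvd_mul_right a b), ZMod.cast_natCast (dvd_mul_left b a)]

/-- `(ψ ⊗ ξ)(e⁻¹(u, v)) = ψ(u) ξ(v)` for the CRT isomorphism `e : ZMod (ab) ≃ ZMod a × ZMod b`,
`(a, b) = 1`. [cite: MontgomeryVaughan2007, Lemma 9.3] -/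
theorem crtProd_apply_symm [NeZero a] [NeZero b] (h : a.Coprime b) (ψ : DirichletCharacter R a)
    (ξ : DirichletCharacter R b) (u : ZMod a) (v : ZMod b) :
    crtProd ψ ξ ((ZMod.chineseRemainder h).symm (u, v)) = ψ u * ξ v := by
  set x := (ZMod.chineseRemainder h).symm (u, v) with hx
  have he : ZMod.chineseRemainder h x = (u, v) := by rw [hx, RingEquiv.apply_symm_apply]
  rw [PrimitiveQuadratic.chineseRemainder_apply h x, Prod.mk.injEq] at he
  rw [crtProd_apply, he.1, he.2]

/-- The first CRT component of `ψ ⊗ ξ` is `ψ`. [cite: MontgomeryVaughan2007, Lemma 9.3] -/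
theorem crtFst_crtProd [NeZero a] [NeZero b] (h : a.Coprime b) (ψ : DirichletCharacter R a)
    (ξ : DirichletCharacter R b) : crtFst h (crtProd ψ ξ) = ψ := by
  refine MulChar.ext fun u => ?_
  rw [crtFst_apply, crtProd_apply_symm h, map_one, mul_one]

/-- The second CRT component of `ψ ⊗ ξ` is `ξ`. [cite: MontgomeryVaughan2007, Lemma 9.3] -/
theorem crtSnd_crtProd [NeZero a] [NeZero b] (h : a.Coprime b) (ψ : DirichletCharacter R a)
    (ξ : DirichletCharacter R b) : crtSnd h (crtProd ψ ξ) = ξ := by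
  refine MulChar.ext fun v => ?_
  rw [crtSnd_apply, crtProd_apply_symm h, map_one, one_mul]

/-- A character mod `a b` is the product of its CRT components. [cite: MontgomeryVaughan2007, Lemma 9.3] -/
theorem crtProd_crtFst_crtSnd [NeZero a] [NeZero b] (h : a.Coprime b)
    (χ : DirichletCharacter R (a * b)) : crtProd (crtFst h χ) (crtSnd h χ) = χ := by
  haveI : NeZero (a * b) := ⟨mul_ne_zero (NeZero.ne a) (NeZero.ne b)⟩
  refine MulChar.ext fun x => ?_
  rw [crtProd_apply, ← apply_eq_crtFst_mul_crtSnd h χ]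

/-- `(ψ, ξ) ↦ ψ ⊗ ξ` is injective (for `(a, b) = 1`). [cite: MontgomeryVaughan2007, Lemma 9.3] -/
theorem crtProd_injective [NeZero a] [NeZero b] (h : a.Coprime b) {ψ ψ' : DirichletCharacter R a}
    {ξ ξ' : DirichletCharacter R b} (he : crtProd ψ ξ = crtProd ψ' ξ') : ψ = ψ' ∧ ξ = ξ' := by
  constructor
  · rw [← crtFst_crtProd h ψ ξ, he, crtFst_crtProd h]
  · rw [← crtSnd_crtProd h ψ ξ, he, crtSnd_crtProd h]

/-! ### Primitivity of the product -/

/-- Integer arithmetic behind the primitivity of `ψ ⊗ ξ`: if `d ∣ a b` with `(a, b) = 1` and an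
integer `X` satisfies `X ≡ 1 (mod gcd(d, a))` and `X ≡ 1 (mod b)`, then `X ≡ 1 (mod d)`. [folklore] -/
theorem int_dvd_sub_one_of_gcd (h : a.Coprime b) {d : ℕ} (hd : d ∣ a * b) {X : ℤ}
    (h1 : ((Nat.gcd d a : ℕ) : ℤ) ∣ X - 1) (h2 : ((b : ℕ) : ℤ) ∣ X - 1) : ((d : ℕ) : ℤ) ∣ X - 1 := by
  -- `d = gcd(d, ab) = gcd(d, a) gcd(d, b) ∣ gcd(d, a) · b`
  have hd' : d ∣ Nat.gcd d a * b := by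
    have e1 : Nat.gcd d (a * b) = d := Nat.gcd_eq_left hd
    have e2 : Nat.gcd d (a * b) = Nat.gcd d a * Nat.gcd d b := Nat.Coprime.gcd_mul d h
    calc d = Nat.gcd d a * Nat.gcd d b := by rw [← e2, e1]
      _ ∣ Nat.gcd d a * b := mul_dvd_mul_left _ (Nat.gcd_dvd_right d b)
  have hcop : IsCoprime ((Nat.gcd d a : ℕ) : ℤ) ((b : ℕ) : ℤ) :=
    Nat.isCoprime_iff_coprime.2 (Nat.Coprime.coprime_dvd_left (Nat.gcd_dvd_right d a) h)
  have h12 : ((Nat.gcd d a : ℕ) : ℤ) * ((b : ℕ) : ℤ) ∣ X - 1 := IsCoprime.mul_dvd hcop h1 h2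
  exact dvd_trans (by exact_mod_cast hd') h12

variable [NeZero a] [NeZero b]

/-- If `ψ ⊗ ξ` factors through `d ∣ a b`, then `ψ` factors through `gcd(d, a)`: a unit `u mod a` with
`u ≡ 1 (mod gcd(d, a))` lifts to `x = e⁻¹(u, 1) ≡ 1 (mod d)`, so `ψ(u) = (ψ ⊗ ξ)(x) = 1`.
[cite: MontgomeryVaughan2007, Lemma 9.3] -/
theorem factorsThrough_gcd_of_crtProd (h : a.Coprime b) (ψ : DirichletCharacter R a)
    (ξ : DirichletCharacter R b) {d : ℕ} (hfac : (crtProd ψ ξ).FactorsThrough d) :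
    ψ.FactorsThrough (Nat.gcd d a) := by
  haveI : NeZero (a * b) := ⟨mul_ne_zero (NeZero.ne a) (NeZero.ne b)⟩
  have hd : d ∣ a * b := hfac.dvd
  obtain ⟨hd', χ₀, hχ₀⟩ := hfac
  rw [factorsThrough_iff_ker_unitsMap (Nat.gcd_dvd_right d a)]
  intro u hu
  rw [MonoidHom.mem_ker, Units.ext_iff, ZMod.unitsMap_def, Units.coe_map, MonoidHom.coe_coe,
    ZMod.castHom_apply, Units.val_one] at hu
  -- the CRT lift `x` of `(u, 1)` and an integer representative `X`
  set x : ZMod (a * b) := (ZMod.chineseRemainder h).symm ((u : ZMod a), 1) with hxdef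
  have hxu : IsUnit x := isUnit_symm_mk_one h u.isUnit
  set X : ℤ := ((x.val : ℕ) : ℤ) with hXdef
  have hXx : (X : ZMod (a * b)) = x := by rw [hXdef, Int.cast_natCast, ZMod.natCast_zmod_val]
  have hex : ZMod.chineseRemainder h x = ((u : ZMod a), 1) := by rw [hxdef, RingEquiv.apply_symm_apply]
  rw [PrimitiveQuadratic.chineseRemainder_apply h x, Prod.mk.injEq] at hex
  -- `X ≡ u (mod a)`, hence `X ≡ 1 (mod gcd(d, a))`; and `X ≡ 1 (mod b)`
  have hXa : (X : ZMod a) = (u : ZMod a) := by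
    rw [← hex.1, ← hXx, ZMod.cast_intCast (dvd_mul_right a b)]
  have hX1 : (X : ZMod (Nat.gcd d a)) = 1 := by
    have : (ZMod.cast ((X : ZMod a)) : ZMod (Nat.gcd d a)) = 1 := by rw [hXa]; exact hu
    rwa [ZMod.cast_intCast (Nat.gcd_dvd_right d a)] at this
  have hXb : (X : ZMod b) = 1 := by
    rw [← hex.2, ← hXx, ZMod.cast_intCast (dvd_mul_left b a)]
  have h1 : ((Nat.gcd d a : ℕ) : ℤ) ∣ X - 1 := by
    rw [← ZMod.intCast_zmod_eq_zero_iff_dvd]; push_cast; rw [hX1, sub_self]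
  have h2 : ((b : ℕ) : ℤ) ∣ X - 1 := by
    rw [← ZMod.intCast_zmod_eq_zero_iff_dvd]; push_cast; rw [hXb, sub_self]
  have hXd : (X : ZMod d) = 1 := by
    have h3 := int_dvd_sub_one_of_gcd h hd h1 h2
    rw [← ZMod.intCast_zmod_eq_zero_iff_dvd] at h3
    push_cast at h3
    rwa [sub_eq_zero] at h3
  -- `(ψ ⊗ ξ)(x) = χ₀(x mod d) = χ₀(1) = 1`
  have hχx : crtProd ψ ξ x = 1 := by
    obtain ⟨ux, hux⟩ := hxu
    rw [← hux, hχ₀, changeLevel_eq_cast_of_dvd χ₀ hd' ux]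
    have : (ZMod.cast (ux : ZMod (a * b)) : ZMod d) = 1 := by
      rw [hux, ← hXx, ZMod.cast_intCast hd', hXd]
    rw [this, map_one]
  -- and `(ψ ⊗ ξ)(x) = ψ(u) ξ(1) = ψ(u)`
  rw [hxdef, crtProd_apply_symm h, map_one, mul_one] at hχx
  rw [MonoidHom.mem_ker, Units.ext_iff, MulChar.coe_toUnitHom, Units.val_one]
  exact hχx

/-- Symmetrically: if `ψ ⊗ ξ` factors through `d ∣ a b`, then `ξ` factors through `gcd(d, b)`.
[cite: MontgomeryVaughan2007, Lemma 9.3] -/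
theorem factorsThrough_gcd_of_crtProd' (h : a.Coprime b) (ψ : DirichletCharacter R a)
    (ξ : DirichletCharacter R b) {d : ℕ} (hfac : (crtProd ψ ξ).FactorsThrough d) :
    ξ.FactorsThrough (Nat.gcd d b) := by
  haveI : NeZero (a * b) := ⟨mul_ne_zero (NeZero.ne a) (NeZero.ne b)⟩
  have hd : d ∣ a * b := hfac.dvd
  obtain ⟨hd', χ₀, hχ₀⟩ := hfac
  rw [factorsThrough_iff_ker_unitsMap (Nat.gcd_dvd_right d b)]
  intro v hv
  rw [MonoidHom.mem_ker, Units.ext_iff, ZMod.unitsMap_def, Units.coe_map, MonoidHom.coe_coe,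
    ZMod.castHom_apply, Units.val_one] at hv
  set x : ZMod (a * b) := (ZMod.chineseRemainder h).symm (1, (v : ZMod b)) with hxdef
  have hxu : IsUnit x := isUnit_symm_one_mk h v.isUnit
  set X : ℤ := ((x.val : ℕ) : ℤ) with hXdef
  have hXx : (X : ZMod (a * b)) = x := by rw [hXdef, Int.cast_natCast, ZMod.natCast_zmod_val]
  have hex : ZMod.chineseRemainder h x = (1, (v : ZMod b)) := by rw [hxdef, RingEquiv.apply_symm_apply]
  rw [PrimitiveQuadratic.chineseRemainder_apply h x, Prod.mk.injEq] at hex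
  have hXb : (X : ZMod b) = (v : ZMod b) := by
    rw [← hex.2, ← hXx, ZMod.cast_intCast (dvd_mul_left b a)]
  have hX1 : (X : ZMod (Nat.gcd d b)) = 1 := by
    have : (ZMod.cast ((X : ZMod b)) : ZMod (Nat.gcd d b)) = 1 := by rw [hXb]; exact hv
    rwa [ZMod.cast_intCast (Nat.gcd_dvd_right d b)] at this
  have hXa : (X : ZMod a) = 1 := by
    rw [← hex.1, ← hXx, ZMod.cast_intCast (dvd_mul_right a b)]
  have h1 : ((Nat.gcd d b : ℕ) : ℤ) ∣ X - 1 := by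
    rw [← ZMod.intCast_zmod_eq_zero_iff_dvd]; push_cast; rw [hX1, sub_self]
  have h2 : ((a : ℕ) : ℤ) ∣ X - 1 := by
    rw [← ZMod.intCast_zmod_eq_zero_iff_dvd]; push_cast; rw [hXa, sub_self]
  have hXd : (X : ZMod d) = 1 := by
    have hd2 : d ∣ b * a := by rwa [mul_comm]
    have h3 := int_dvd_sub_one_of_gcd h.symm hd2 h1 h2
    rw [← ZMod.intCast_zmod_eq_zero_iff_dvd] at h3
    push_cast at h3
    rwa [sub_eq_zero] at h3
  have hχx : crtProd ψ ξ x = 1 := by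
    obtain ⟨ux, hux⟩ := hxu
    rw [← hux, hχ₀, changeLevel_eq_cast_of_dvd χ₀ hd' ux]
    have : (ZMod.cast (ux : ZMod (a * b)) : ZMod d) = 1 := by
      rw [hux, ← hXx, ZMod.cast_intCast hd', hXd]
    rw [this, map_one]
  rw [hxdef, crtProd_apply_symm h, map_one, one_mul] at hχx
  rw [MonoidHom.mem_ker, Units.ext_iff, MulChar.coe_toUnitHom, Units.val_one]
  exact hχx

/-- **The product of primitive characters to coprime moduli is primitive** (Montgomery–Vaughan,
Lemma 9.3, the "if" direction): `ψ mod a` and `ξ mod b` primitive, `(a, b) = 1` ⟹ `ψ ⊗ ξ` is a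
primitive character mod `a b`. [cite: MontgomeryVaughan2007, Lemma 9.3] -/
theorem isPrimitive_crtProd (h : a.Coprime b) {ψ : DirichletCharacter R a} {ξ : DirichletCharacter R b}
    (hψ : ψ.IsPrimitive) (hξ : ξ.IsPrimitive) : (crtProd ψ ξ).IsPrimitive := by
  haveI : NeZero (a * b) := ⟨mul_ne_zero (NeZero.ne a) (NeZero.ne b)⟩
  set d := (crtProd ψ ξ).conductor with hd_def
  have hd : d ∣ a * b := conductor_dvd_level _
  have hfac : (crtProd ψ ξ).FactorsThrough d := factorsThrough_conductor _
  -- `a ∣ d`: `ψ` factors through `gcd(d, a)`, so `a = cond ψ ∣ gcd(d, a) ∣ d`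
  have ha : a ∣ d := by
    have h1 := factorsThrough_gcd_of_crtProd h ψ ξ hfac
    have h2 : ψ.conductor ∣ Nat.gcd d a :=
      (mem_conductorSet_iff_conductor_dvd ψ (Nat.gcd_dvd_right d a)).mp h1
    rw [hψ] at h2
    exact h2.trans (Nat.gcd_dvd_left d a)
  have hb : b ∣ d := by
    have h1 := factorsThrough_gcd_of_crtProd' h ψ ξ hfac
    have h2 : ξ.conductor ∣ Nat.gcd d b :=
      (mem_conductorSet_iff_conductor_dvd ξ (Nat.gcd_dvd_right d b)).mp h1
    rw [hξ] at h2
    exact h2.trans (Nat.gcd_dvd_left d b)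
  have hab : a * b ∣ d := Nat.Coprime.mul_dvd_of_dvd_of_dvd h ha hb
  exact Nat.dvd_antisymm hd hab

end Literature.NumberTheory.LFunctions

end
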